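import Summits.CriticalPhenomena.Ising3DConformalLimit.Theses.FKParityRobustness
import Summits.CriticalPhenomena.Ising3DConformalLimit.Theorems.FKParityRobustnessIndependentStrandsJoinStubSeparation
import Summits.CriticalPhenomena.Ising3DConformalLimit.Theorems.FKParityRobustnessIndependentStrandsJoinStubPairSplit
import Summits.CriticalPhenomena.Ising3DConformalLimit.Theorems.FKParityRobustnessIndependentStrandsJoinStubSymmetry
import Summits.CriticalPhenomena.Ising3DConformalLimit.Theorems.FKParityRobustnessIndependentStrandsJoinStubTransfer
import Summits.CriticalPhenomena.Ising3DConformalLimit.Theorems.FKParityRobustnessIndependentStrandsJoinStubDepletionBound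
import Summits.CriticalPhenomena.Ising3DConformalLimit.Theorems.FKParityRobustnessDepletionBound
import Summits.CriticalPhenomena.Ising3DConformalLimit.Theorems.FKParityRobustnessStrandsJoinBound
import HarnessLib

/-!
# The pairing-summed strand sandwich at a GENERAL four-point shape (finite graphs)

Helper file of the crux `IndependentStrandsJoin` (item stmt-CriticalPhenomena-14625, route `FKParityRobustness`; line
`pinch-to-tetra` r5, lead c5-0).  Every finite graph `G`, `β ≥ 0`, `t = tanh β`, four distinct marked vertices `a`; `Z^S` the
loop-O(1) partition functions, `jointSum(xy|zw) = Σ_{F₁ ∈ 𝒯(xy)} Σ_{F₂ ∈ 𝒯(zw)} t^{|F₁|+|F₂|}·1[x ↔ z in F₁ ∪ F₂]` (the crux's joint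
sum), `meetSum(xy|zw)` (the clusters of `x` in `F₁` and of `z` in `F₂` share a vertex).
* `sepSum_three_le` — the three "separated" classes of `𝒯(a₀a₁a₂a₃)` are pairwise disjoint (handshake, landed
  `not_separated_of_mem_tJoins`), so their weights add up to at most `Z^{0123}` (general-shape substitute for the tetrahedral
  `3·sepSum ≤ Z^{0123}` of `stub_symmetry`).
* `neg_connectedFour_mul_sq_le_meetSum3` — **general upper sandwich** `−U₄(a)·(Z⁰)² ≤ Σ_π meetSum_π`: the landed separation bound
  (`stub_separation` ∘ `depletionBound_proof` ∘ `stub_pairSplit`) at the relabellings `a`, `(a₀,a₂,a₁,a₃)`, `(a₀,a₃,a₁,a₂)`, summed,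
  plus the HT identity `U₄·(Z⁰)² = Z^{0123}Z⁰ − Σ_π Z^{π₁}Z^{π₂}`; with `meetSum ≤ jointSum` (`meetSum_le_jointSum'`):
  `neg_connectedFour_mul_sq_le_jointSum3`.
* `connectedFour_mul_sq_le_of_jointSum3` — the closed `StrandsJoinBound` (item stmt-CriticalPhenomena-14647) at the three relabellings
  and the symmetry of `U₄` (`connectedFour_swap12`, `connectedFour_rot123`): `3·U₄·(Z⁰)² ≤ −2·Σ_π jointSum_π`.
So `(2/3)·Σ_π jointSum_π ≤ −U₄·(Z⁰)² ≤ Σ_π jointSum_π` on every graph, with NO symmetry of the shape (registered sub-goal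
`stub_shapeSandwich`; the finite-graph half of the loop-language ∃-shape dictionary `…ShapeLoopDictionary.lean`).

References: M. Aizenman, Comm. Math. Phys. 86 (1982), Prop. 5.3 [AizenmanCMP1982]; M. Aizenman, R. Fernández, J. Stat. Phys. 44
(1986), Claim 4.15 [AizenmanFernandez1986]; U. T. Hansen, J. Jiang, F. R. Klausen, arXiv:2506.10765, §2 [HansenJiangKlausen2025].
-/

noncomputable section

open Finset SimpleGraph
open Literature.Probability.LatticeModels
open Summit.CriticalPhenomena.Ising3DConformalLimit.Theses.FKParityRobustness

namespace Summit.CriticalPhenomena.Ising3DConformalLimit.Cruxes.IndependentStrandsJoin.PinchToTetra.ShapeSandwich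

open scoped Classical BigOperators

-- `V : Type` (universe 0): the landed finite-graph statements quantify over `V : Type`.
variable {V : Type} [Fintype V] [DecidableEq V] (G : SimpleGraph V) [DecidableRel G.Adj]

/-! ## Relabellings of a marked quadruple -/

/-- The image of a `Fin 4`-indexed family is the four-element set of its values. [folklore] -/
theorem image_univ_four {α : Type*} [DecidableEq α] (a : Fin 4 → α) :
    Finset.univ.image a = {a 0, a 1, a 2, a 3} := by
  ext v
  simp only [Finset.mem_image, Finset.mem_univ, true_and, Finset.mem_insert, Finset.mem_singleton]
  constructor
  · rintro ⟨i, rfl⟩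
    fin_cases i <;> simp
  · rintro (rfl | rfl | rfl | rfl)
    exacts [⟨0, rfl⟩, ⟨1, rfl⟩, ⟨2, rfl⟩, ⟨3, rfl⟩]

/-- The relabelling `(a₀,a₂,a₁,a₃)` as a composition with a permutation of the indices. [folklore] -/
theorem swap12_eq_comp {α : Type*} (a : Fin 4 → α) :
    (![a 0, a 2, a 1, a 3] : Fin 4 → α) = a ∘ (![0, 2, 1, 3] : Fin 4 → Fin 4) := by
  funext i
  fin_cases i <;> rfl

/-- The relabelling `(a₀,a₃,a₁,a₂)` as a composition with a permutation of the indices. [folklore] -/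
theorem rot123_eq_comp {α : Type*} (a : Fin 4 → α) :
    (![a 0, a 3, a 1, a 2] : Fin 4 → α) = a ∘ (![0, 3, 1, 2] : Fin 4 → Fin 4) := by
  funext i
  fin_cases i <;> rfl

/-- The relabelling `(a₀,a₂,a₁,a₃)` has the same source set. [folklore] -/
theorem image_univ_swap12 {α : Type*} [DecidableEq α] (a : Fin 4 → α) :
    Finset.univ.image ![a 0, a 2, a 1, a 3] = Finset.univ.image a := by
  rw [image_univ_four, image_univ_four]
  change ({a 0, a 2, a 1, a 3} : Finset α) = {a 0, a 1, a 2, a 3}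
  ext v
  simp only [Finset.mem_insert, Finset.mem_singleton]
  tauto

/-- The relabelling `(a₀,a₃,a₁,a₂)` has the same source set. [folklore] -/
theorem image_univ_rot123 {α : Type*} [DecidableEq α] (a : Fin 4 → α) :
    Finset.univ.image ![a 0, a 3, a 1, a 2] = Finset.univ.image a := by
  rw [image_univ_four, image_univ_four]
  change ({a 0, a 3, a 1, a 2} : Finset α) = {a 0, a 1, a 2, a 3}
  ext v
  simp only [Finset.mem_insert, Finset.mem_singleton]
  tauto

/-- Injectivity survives the relabelling `(a₀,a₂,a₁,a₃)`. [folklore] -/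
theorem injective_swap12 {α : Type*} {a : Fin 4 → α} (ha : Function.Injective a) :
    Function.Injective (![a 0, a 2, a 1, a 3] : Fin 4 → α) := by
  rw [swap12_eq_comp]
  exact ha.comp (by decide : Function.Injective (![0, 2, 1, 3] : Fin 4 → Fin 4))

/-- Injectivity survives the relabelling `(a₀,a₃,a₁,a₂)`. [folklore] -/
theorem injective_rot123 {α : Type*} {a : Fin 4 → α} (ha : Function.Injective a) :
    Function.Injective (![a 0, a 3, a 1, a 2] : Fin 4 → α) := by
  rw [rot123_eq_comp]
  exact ha.comp (by decide : Function.Injective (![0, 3, 1, 2] : Fin 4 → Fin 4))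

/-! ## Symmetry of the Ursell function under the two relabellings -/

/-- Values of the relabelling `(a₀,a₂,a₁,a₃)`. [folklore] -/
theorem swap12_apply {α : Type*} (a : Fin 4 → α) :
    (![a 0, a 2, a 1, a 3] : Fin 4 → α) 0 = a 0 ∧ (![a 0, a 2, a 1, a 3] : Fin 4 → α) 1 = a 2 ∧
      (![a 0, a 2, a 1, a 3] : Fin 4 → α) 2 = a 1 ∧ (![a 0, a 2, a 1, a 3] : Fin 4 → α) 3 = a 3 :=
  ⟨rfl, rfl, rfl, rfl⟩

/-- Values of the relabelling `(a₀,a₃,a₁,a₂)`. [folklore] -/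
theorem rot123_apply {α : Type*} (a : Fin 4 → α) :
    (![a 0, a 3, a 1, a 2] : Fin 4 → α) 0 = a 0 ∧ (![a 0, a 3, a 1, a 2] : Fin 4 → α) 1 = a 3 ∧
      (![a 0, a 3, a 1, a 2] : Fin 4 → α) 2 = a 1 ∧ (![a 0, a 3, a 1, a 2] : Fin 4 → α) 3 = a 2 :=
  ⟨rfl, rfl, rfl, rfl⟩

omit [Fintype V] [DecidableEq V] in
/-- `U₄` is invariant under the relabelling `(a₀,a₂,a₁,a₃)` (the four-point function is a symmetric product and the
three pair products are permuted). [folklore] -/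
theorem connectedFour_swap12 {Ω : Type*} [MeasurableSpace Ω] (μ : MeasureTheory.Measure Ω) (σ : V → Ω → ℝ)
    (a : Fin 4 → V) :
    connectedFour μ σ ![a 0, a 2, a 1, a 3] = connectedFour μ σ a := by
  have h4 : nPoint μ σ ![a 0, a 2, a 1, a 3] = nPoint μ σ a := by
    unfold nPoint
    congr 1
    funext ω
    simp only [Fin.prod_univ_four]
    rw [(swap12_apply a).1, (swap12_apply a).2.1, (swap12_apply a).2.2.1, (swap12_apply a).2.2.2]
    ring
  unfold connectedFour
  rw [h4, (swap12_apply a).1, (swap12_apply a).2.1, (swap12_apply a).2.2.1, (swap12_apply a).2.2.2,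
    twoPoint_comm μ σ (a 2) (a 1)]
  ring

omit [Fintype V] [DecidableEq V] in
/-- `U₄` is invariant under the relabelling `(a₀,a₃,a₁,a₂)`. [folklore] -/
theorem connectedFour_rot123 {Ω : Type*} [MeasurableSpace Ω] (μ : MeasureTheory.Measure Ω) (σ : V → Ω → ℝ)
    (a : Fin 4 → V) :
    connectedFour μ σ ![a 0, a 3, a 1, a 2] = connectedFour μ σ a := by
  have h4 : nPoint μ σ ![a 0, a 3, a 1, a 2] = nPoint μ σ a := by
    unfold nPoint
    congr 1
    funext ω
    simp only [Fin.prod_univ_four]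
    rw [(rot123_apply a).1, (rot123_apply a).2.1, (rot123_apply a).2.2.1, (rot123_apply a).2.2.2]
    ring
  unfold connectedFour
  rw [h4, (rot123_apply a).1, (rot123_apply a).2.1, (rot123_apply a).2.2.1, (rot123_apply a).2.2.2,
    twoPoint_comm μ σ (a 3) (a 1), twoPoint_comm μ σ (a 3) (a 2)]
  ring

/-! ## The three separated classes are disjoint -/

/-- **`sepSum(01|23) + sepSum(02|13) + sepSum(03|12) ≤ Z^{0123}`** for `t ≥ 0`: the three classes of `T`-joins of
`{a₀,a₁,a₂,a₃}` in which the cluster of `a₀` avoids `{a₂,a₃}`, resp. `{a₁,a₃}`, resp. `{a₁,a₂}`, are pairwise disjoint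
(a `T`-join cannot separate `a₀` from all three other sources, `not_separated_of_mem_tJoins`), and the weights `t^{|D|}`
are nonnegative. [folklore] -/
theorem sepSum_three_le {t : ℝ} (ht : 0 ≤ t) (a : Fin 4 → V) :
    (∑ D ∈ (tJoins G Set.univ (Finset.univ.image a)).filter (fun D : Finset (Sym2 V) =>
        ¬ (fromEdgeSet (↑D : Set (Sym2 V))).Reachable (a 0) (a 2) ∧
        ¬ (fromEdgeSet (↑D : Set (Sym2 V))).Reachable (a 0) (a 3)), t ^ D.card) +
    (∑ D ∈ (tJoins G Set.univ (Finset.univ.image a)).filter (fun D : Finset (Sym2 V) =>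
        ¬ (fromEdgeSet (↑D : Set (Sym2 V))).Reachable (a 0) (a 1) ∧
        ¬ (fromEdgeSet (↑D : Set (Sym2 V))).Reachable (a 0) (a 3)), t ^ D.card) +
    (∑ D ∈ (tJoins G Set.univ (Finset.univ.image a)).filter (fun D : Finset (Sym2 V) =>
        ¬ (fromEdgeSet (↑D : Set (Sym2 V))).Reachable (a 0) (a 1) ∧
        ¬ (fromEdgeSet (↑D : Set (Sym2 V))).Reachable (a 0) (a 2)), t ^ D.card)
      ≤ loopO1PartitionFunction G t (Finset.univ.image a) := by
  set T := tJoins G Set.univ (Finset.univ.image a) with hT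
  set P₁ : Finset (Sym2 V) → Prop := fun D =>
    ¬ (fromEdgeSet (↑D : Set (Sym2 V))).Reachable (a 0) (a 2) ∧
    ¬ (fromEdgeSet (↑D : Set (Sym2 V))).Reachable (a 0) (a 3) with hP₁
  set P₂ : Finset (Sym2 V) → Prop := fun D =>
    ¬ (fromEdgeSet (↑D : Set (Sym2 V))).Reachable (a 0) (a 1) ∧
    ¬ (fromEdgeSet (↑D : Set (Sym2 V))).Reachable (a 0) (a 3) with hP₂
  set P₃ : Finset (Sym2 V) → Prop := fun D =>
    ¬ (fromEdgeSet (↑D : Set (Sym2 V))).Reachable (a 0) (a 1) ∧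
    ¬ (fromEdgeSet (↑D : Set (Sym2 V))).Reachable (a 0) (a 2) with hP₃
  have hx₁₂ : ∀ D ∈ T, P₁ D → P₂ D → False := fun D hD h₁ h₂ =>
    Summit.CriticalPhenomena.Ising3DConformalLimit.Theorems.StubSymmetry.not_separated_of_mem_tJoins a hD h₂.1 h₁.1 h₁.2
  have hx₁₃ : ∀ D ∈ T, P₁ D → P₃ D → False := fun D hD h₁ h₃ =>
    Summit.CriticalPhenomena.Ising3DConformalLimit.Theorems.StubSymmetry.not_separated_of_mem_tJoins a hD h₃.1 h₁.1 h₁.2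
  have hx₂₃ : ∀ D ∈ T, P₂ D → P₃ D → False := fun D hD h₂ h₃ =>
    Summit.CriticalPhenomena.Ising3DConformalLimit.Theorems.StubSymmetry.not_separated_of_mem_tJoins a hD h₂.1 h₃.2 h₂.2
  have hd₁₂ : Disjoint (T.filter P₁) (T.filter P₂) := Finset.disjoint_filter.2 hx₁₂
  have hd₁₃ : Disjoint (T.filter P₁) (T.filter P₃) := Finset.disjoint_filter.2 hx₁₃
  have hd₂₃ : Disjoint (T.filter P₂) (T.filter P₃) := Finset.disjoint_filter.2 hx₂₃
  have hsub : T.filter P₁ ∪ T.filter P₂ ∪ T.filter P₃ ⊆ T :=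
    Finset.union_subset (Finset.union_subset (Finset.filter_subset _ _) (Finset.filter_subset _ _))
      (Finset.filter_subset _ _)
  rw [Summit.CriticalPhenomena.Ising3DConformalLimit.Theorems.DepletionBound.loopO1PartitionFunction_eq_hteSum,
    ← Summit.CriticalPhenomena.Ising3DConformalLimit.Theorems.DepletionBound.sum_tJoins_pow_eq_hteSum]
  calc (∑ D ∈ T.filter P₁, t ^ D.card) + (∑ D ∈ T.filter P₂, t ^ D.card) + (∑ D ∈ T.filter P₃, t ^ D.card)
      = ∑ D ∈ T.filter P₁ ∪ T.filter P₂ ∪ T.filter P₃, t ^ D.card := by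
        rw [Finset.sum_union (Finset.disjoint_union_left.2 ⟨hd₁₃, hd₂₃⟩), Finset.sum_union hd₁₂]
    _ ≤ ∑ D ∈ T, t ^ D.card :=
        Finset.sum_le_sum_of_subset_of_nonneg hsub fun D _ _ => pow_nonneg ht _

/-! ## The general upper sandwich -/

/-- **`−U₄(a)·(Z⁰)² ≤ meetSum(01|23) + meetSum(02|13) + meetSum(03|12)`** on every finite graph (`β ≥ 0`, `a` injective):
the landed separation bound `Z^{xy}Z^{zw} − meetSum(xy|zw) ≤ sepSum(xy|zw)·Z⁰` at the three relabellings, summed,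
`Σ_π sepSum_π ≤ Z^{0123}` (`sepSum_three_le`), and the high-temperature identity
`U₄·(Z⁰)² = Z^{0123}Z⁰ − Σ_π Z^{π₁}Z^{π₂}`. [folklore] -/
theorem neg_connectedFour_mul_sq_le_meetSum3 {β : ℝ} (hβ : 0 ≤ β) (a : Fin 4 → V) (ha : Function.Injective a) :
    -(connectedFour (isingMeasure G Finset.univ β 0 .free) spinAt a) *
        (loopO1PartitionFunction G (Real.tanh β) ∅) ^ 2 ≤
      (∑ F₁ ∈ tJoins G Set.univ {a 0, a 1}, ∑ F₂ ∈ tJoins G Set.univ {a 2, a 3},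
          if ∃ v : V, (fromEdgeSet (↑F₁ : Set (Sym2 V))).Reachable (a 0) v ∧
              (fromEdgeSet (↑F₂ : Set (Sym2 V))).Reachable (a 2) v
          then Real.tanh β ^ (F₁.card + F₂.card) else 0) +
      (∑ F₁ ∈ tJoins G Set.univ {a 0, a 2}, ∑ F₂ ∈ tJoins G Set.univ {a 1, a 3},
          if ∃ v : V, (fromEdgeSet (↑F₁ : Set (Sym2 V))).Reachable (a 0) v ∧
              (fromEdgeSet (↑F₂ : Set (Sym2 V))).Reachable (a 1) v
          then Real.tanh β ^ (F₁.card + F₂.card) else 0) +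
      (∑ F₁ ∈ tJoins G Set.univ {a 0, a 3}, ∑ F₂ ∈ tJoins G Set.univ {a 1, a 2},
          if ∃ v : V, (fromEdgeSet (↑F₁ : Set (Sym2 V))).Reachable (a 0) v ∧
              (fromEdgeSet (↑F₂ : Set (Sym2 V))).Reachable (a 1) v
          then Real.tanh β ^ (F₁.card + F₂.card) else 0) := by
  have ht : 0 ≤ Real.tanh β := by
    rw [Real.tanh_eq_sinh_div_cosh]
    exact div_nonneg (Real.sinh_nonneg_iff.2 hβ) (Real.cosh_pos _).le
  have hZ0 : 0 < loopO1PartitionFunction G (Real.tanh β) ∅ := loopO1PartitionFunction_empty_pos G ht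
  -- the separation bound at the three relabellings
  have hsep := Summit.CriticalPhenomena.Ising3DConformalLimit.Theorems.stub_separation
    Summit.CriticalPhenomena.Ising3DConformalLimit.Theorems.depletionBound_proof
    Summit.CriticalPhenomena.Ising3DConformalLimit.Theorems.stub_pairSplit
  have h₁ := hsep V G β hβ a ha
  have h₂ := hsep V G β hβ ![a 0, a 2, a 1, a 3] (injective_swap12 ha)
  have h₃ := hsep V G β hβ ![a 0, a 3, a 1, a 2] (injective_rot123 ha)
  rw [(swap12_apply a).1, (swap12_apply a).2.1, (swap12_apply a).2.2.1, (swap12_apply a).2.2.2,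
    image_univ_swap12] at h₂
  rw [(rot123_apply a).1, (rot123_apply a).2.1, (rot123_apply a).2.2.1, (rot123_apply a).2.2.2,
    image_univ_rot123] at h₃
  -- the three classes are disjoint
  have h3 := sepSum_three_le G ht a
  -- high-temperature expansion on the whole vertex set: `⟨σ_A⟩^free_G = Z^A / Z⁰`
  have hcorr : ∀ A : Finset V, isingCorr G Finset.univ β 0 .free A =
      loopO1PartitionFunction G (Real.tanh β) A / loopO1PartitionFunction G (Real.tanh β) ∅ :=
    fun A => by
      rw [isingCorr_free_eq_hteSum_div G Finset.univ β (Finset.subset_univ A),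
        Summit.CriticalPhenomena.Ising3DConformalLimit.Theorems.DepletionBound.loopO1PartitionFunction_eq_hteSum,
        Summit.CriticalPhenomena.Ising3DConformalLimit.Theorems.DepletionBound.loopO1PartitionFunction_eq_hteSum]
  have e4 : nPoint (isingMeasure G Finset.univ β 0 .free) spinAt a =
      loopO1PartitionFunction G (Real.tanh β) (Finset.univ.image a) /
        loopO1PartitionFunction G (Real.tanh β) ∅ := by
    have hmono : spinMonomial a = spinProduct (Finset.univ.image a) := by
      funext s
      unfold spinMonomial spinProduct
      rw [Finset.prod_image fun i _ j _ h => ha h]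
    rw [← hcorr, isingCorr, ← hmono]
    rfl
  have e2 : ∀ x y : V, x ≠ y → twoPoint (isingMeasure G Finset.univ β 0 .free) spinAt x y =
      loopO1PartitionFunction G (Real.tanh β) {x, y} / loopO1PartitionFunction G (Real.tanh β) ∅ :=
    fun x y hxy => by
      rw [← hcorr, ← isingTwoPoint_eq_isingCorr G Finset.univ β 0 .free hxy]
      rfl
  have e01 := e2 _ _ (ha.ne (by decide) : a 0 ≠ a 1)
  have e23 := e2 _ _ (ha.ne (by decide) : a 2 ≠ a 3)
  have e02 := e2 _ _ (ha.ne (by decide) : a 0 ≠ a 2)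
  have e13 := e2 _ _ (ha.ne (by decide) : a 1 ≠ a 3)
  have e03 := e2 _ _ (ha.ne (by decide) : a 0 ≠ a 3)
  have e12 := e2 _ _ (ha.ne (by decide) : a 1 ≠ a 2)
  set Z0 := loopO1PartitionFunction G (Real.tanh β) ∅ with hZ0_def
  set ZA := loopO1PartitionFunction G (Real.tanh β) (Finset.univ.image a) with hZA_def
  set Z01 := loopO1PartitionFunction G (Real.tanh β) {a 0, a 1} with hZ01_def
  set Z23 := loopO1PartitionFunction G (Real.tanh β) {a 2, a 3} with hZ23_def
  set Z02 := loopO1PartitionFunction G (Real.tanh β) {a 0, a 2} with hZ02_def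
  set Z13 := loopO1PartitionFunction G (Real.tanh β) {a 1, a 3} with hZ13_def
  set Z03 := loopO1PartitionFunction G (Real.tanh β) {a 0, a 3} with hZ03_def
  set Z12 := loopO1PartitionFunction G (Real.tanh β) {a 1, a 2} with hZ12_def
  have hZ0' : Z0 ≠ 0 := hZ0.ne'
  have hU4 : connectedFour (isingMeasure G Finset.univ β 0 .free) spinAt a =
      (ZA * Z0 - Z01 * Z23 - Z02 * Z13 - Z03 * Z12) / Z0 ^ 2 := by
    unfold connectedFour
    rw [e4, e01, e23, e02, e13, e03, e12]
    field_simp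
  rw [hU4, show -((ZA * Z0 - Z01 * Z23 - Z02 * Z13 - Z03 * Z12) / Z0 ^ 2) * Z0 ^ 2 =
      Z01 * Z23 + Z02 * Z13 + Z03 * Z12 - ZA * Z0 by field_simp; ring]
  have h3' := mul_le_mul_of_nonneg_right h3 hZ0.le
  nlinarith [h₁, h₂, h₃, h3', hZ0]

/-- **`meetSum ≤ jointSum` termwise** (as the landed `StubTransfer.meetSum_le_jointSum`, re-proved here so that the
`Decidable` instances of the `if`s are the ones elaborated in this file): if the `x`-cluster of `F₁` and the `z`-cluster
of `F₂` share a vertex `v`, then `x ↝ v ↝ z` inside `F₁ ∪ F₂`; the weights are `≥ 0`. [folklore] -/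
theorem meetSum_le_jointSum' {t : ℝ} (ht : 0 ≤ t) (x y z w : V) :
    (∑ F₁ ∈ tJoins G Set.univ {x, y}, ∑ F₂ ∈ tJoins G Set.univ {z, w},
        if ∃ v : V, (fromEdgeSet (↑F₁ : Set (Sym2 V))).Reachable x v ∧
            (fromEdgeSet (↑F₂ : Set (Sym2 V))).Reachable z v
        then t ^ (F₁.card + F₂.card) else 0)
      ≤ ∑ F₁ ∈ tJoins G Set.univ {x, y}, ∑ F₂ ∈ tJoins G Set.univ {z, w},
        if (fromEdgeSet ((↑F₁ : Set (Sym2 V)) ∪ ↑F₂)).Reachable x z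
        then t ^ (F₁.card + F₂.card) else 0 := by
  refine Finset.sum_le_sum fun F₁ _ => Finset.sum_le_sum fun F₂ _ => ?_
  split_ifs with h1 h2 h2
  · exact le_rfl
  · obtain ⟨v, h0v, h2v⟩ := h1
    exact absurd ((h0v.mono (fromEdgeSet_mono Set.subset_union_left)).trans
      (h2v.mono (fromEdgeSet_mono Set.subset_union_right)).symm) h2
  · exact pow_nonneg ht _
  · exact le_rfl

/-- **`−U₄(a)·(Z⁰)² ≤ jointSum(01|23) + jointSum(02|13) + jointSum(03|12)`** on every finite graph: the general upper
sandwich with `meetSum ≤ jointSum` termwise (landed `meetSum_le_jointSum`: a shared vertex joins the strands). [folklore] -/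
theorem neg_connectedFour_mul_sq_le_jointSum3 {β : ℝ} (hβ : 0 ≤ β) (a : Fin 4 → V) (ha : Function.Injective a) :
    -(connectedFour (isingMeasure G Finset.univ β 0 .free) spinAt a) *
        (loopO1PartitionFunction G (Real.tanh β) ∅) ^ 2 ≤
      (∑ F₁ ∈ tJoins G Set.univ {a 0, a 1}, ∑ F₂ ∈ tJoins G Set.univ {a 2, a 3},
          if (fromEdgeSet ((↑F₁ : Set (Sym2 V)) ∪ ↑F₂)).Reachable (a 0) (a 2)
          then Real.tanh β ^ (F₁.card + F₂.card) else 0) +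
      (∑ F₁ ∈ tJoins G Set.univ {a 0, a 2}, ∑ F₂ ∈ tJoins G Set.univ {a 1, a 3},
          if (fromEdgeSet ((↑F₁ : Set (Sym2 V)) ∪ ↑F₂)).Reachable (a 0) (a 1)
          then Real.tanh β ^ (F₁.card + F₂.card) else 0) +
      (∑ F₁ ∈ tJoins G Set.univ {a 0, a 3}, ∑ F₂ ∈ tJoins G Set.univ {a 1, a 2},
          if (fromEdgeSet ((↑F₁ : Set (Sym2 V)) ∪ ↑F₂)).Reachable (a 0) (a 1)
          then Real.tanh β ^ (F₁.card + F₂.card) else 0) := by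
  have ht : 0 ≤ Real.tanh β := by
    rw [Real.tanh_eq_sinh_div_cosh]
    exact div_nonneg (Real.sinh_nonneg_iff.2 hβ) (Real.cosh_pos _).le
  have hm₁ := meetSum_le_jointSum' G ht (a 0) (a 1) (a 2) (a 3)
  have hm₂ := meetSum_le_jointSum' G ht (a 0) (a 2) (a 1) (a 3)
  have hm₃ := meetSum_le_jointSum' G ht (a 0) (a 3) (a 1) (a 2)
  have h := neg_connectedFour_mul_sq_le_meetSum3 G hβ a ha
  linarith

/-! ## The lower sandwich: `StrandsJoinBound` at the three relabellings -/

/-- **`3·U₄(a)·(Z⁰)² ≤ −2·(jointSum(01|23) + jointSum(02|13) + jointSum(03|12))`** on every finite graph: the closed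
item `StrandsJoinBound` (stmt-CriticalPhenomena-14647: `U₄·(Z⁰)² ≤ −2·jointSum(01|23)`) at the three relabellings, with
the symmetry of `U₄` (`connectedFour_swap12`, `connectedFour_rot123`). [cite: AizenmanCMP1982, Prop. 5.3] -/
theorem connectedFour_mul_sq_le_of_jointSum3 {β : ℝ} (hβ : 0 ≤ β) (a : Fin 4 → V) (ha : Function.Injective a) :
    3 * (connectedFour (isingMeasure G Finset.univ β 0 .free) spinAt a *
        (loopO1PartitionFunction G (Real.tanh β) ∅) ^ 2) ≤
      -(2 * ((∑ F₁ ∈ tJoins G Set.univ {a 0, a 1}, ∑ F₂ ∈ tJoins G Set.univ {a 2, a 3},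
          if (fromEdgeSet ((↑F₁ : Set (Sym2 V)) ∪ ↑F₂)).Reachable (a 0) (a 2)
          then Real.tanh β ^ (F₁.card + F₂.card) else 0) +
      (∑ F₁ ∈ tJoins G Set.univ {a 0, a 2}, ∑ F₂ ∈ tJoins G Set.univ {a 1, a 3},
          if (fromEdgeSet ((↑F₁ : Set (Sym2 V)) ∪ ↑F₂)).Reachable (a 0) (a 1)
          then Real.tanh β ^ (F₁.card + F₂.card) else 0) +
      (∑ F₁ ∈ tJoins G Set.univ {a 0, a 3}, ∑ F₂ ∈ tJoins G Set.univ {a 1, a 2},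
          if (fromEdgeSet ((↑F₁ : Set (Sym2 V)) ∪ ↑F₂)).Reachable (a 0) (a 1)
          then Real.tanh β ^ (F₁.card + F₂.card) else 0))) := by
  have hSJB := Summit.CriticalPhenomena.Ising3DConformalLimit.FKParityRobustnessStrandsJoinBound.strandsJoinBound_proof
  have h₁ := hSJB V G β hβ a ha
  have h₂ := hSJB V G β hβ ![a 0, a 2, a 1, a 3] (injective_swap12 ha)
  have h₃ := hSJB V G β hβ ![a 0, a 3, a 1, a 2] (injective_rot123 ha)
  rw [connectedFour_swap12, (swap12_apply a).1, (swap12_apply a).2.1, (swap12_apply a).2.2.1,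
    (swap12_apply a).2.2.2] at h₂
  rw [connectedFour_rot123, (rot123_apply a).1, (rot123_apply a).2.1, (rot123_apply a).2.2.1,
    (rot123_apply a).2.2.2] at h₃
  simp only at h₁ h₂ h₃
  linarith

end Summit.CriticalPhenomena.Ising3DConformalLimit.Cruxes.IndependentStrandsJoin.PinchToTetra.ShapeSandwich

/-! ## The registered sub-goal `stub_shapeSandwich` -/

namespace Summit.CriticalPhenomena.Ising3DConformalLimit.Theorems

open scoped Classical in
/-- **Registered sub-goal `stub_shapeSandwich` of the crux `IndependentStrandsJoin`** (stmt-CriticalPhenomena-14625, line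
`pinch-to-tetra` r5): the general-shape two-sided strand sandwich on every finite graph, `β ≥ 0`, `t = tanh β`, `a` injective:
`3·U₄(a)·(Z⁰)² ≤ −2·Σ_π jointSum_π` and `−U₄(a)·(Z⁰)² ≤ Σ_π jointSum_π`
(`ShapeSandwich.connectedFour_mul_sq_le_of_jointSum3`, `ShapeSandwich.neg_connectedFour_mul_sq_le_jointSum3`). -/
theorem stub_shapeSandwich :
    ∀ (V : Type) [Fintype V] [DecidableEq V] (G : SimpleGraph V) [DecidableRel G.Adj] (β : ℝ), 0 ≤ β →
      ∀ a : Fin 4 → V, Function.Injective a →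
      3 * (connectedFour (isingMeasure G Finset.univ β 0 .free) spinAt a *
          (loopO1PartitionFunction G (Real.tanh β) ∅) ^ 2) ≤
        -(2 * ((∑ F₁ ∈ tJoins G Set.univ {a 0, a 1}, ∑ F₂ ∈ tJoins G Set.univ {a 2, a 3},
            if (SimpleGraph.fromEdgeSet ((↑F₁ : Set (Sym2 V)) ∪ ↑F₂)).Reachable (a 0) (a 2)
            then Real.tanh β ^ (F₁.card + F₂.card) else 0) +
          (∑ F₁ ∈ tJoins G Set.univ {a 0, a 2}, ∑ F₂ ∈ tJoins G Set.univ {a 1, a 3},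
            if (SimpleGraph.fromEdgeSet ((↑F₁ : Set (Sym2 V)) ∪ ↑F₂)).Reachable (a 0) (a 1)
            then Real.tanh β ^ (F₁.card + F₂.card) else 0) +
          (∑ F₁ ∈ tJoins G Set.univ {a 0, a 3}, ∑ F₂ ∈ tJoins G Set.univ {a 1, a 2},
            if (SimpleGraph.fromEdgeSet ((↑F₁ : Set (Sym2 V)) ∪ ↑F₂)).Reachable (a 0) (a 1)
            then Real.tanh β ^ (F₁.card + F₂.card) else 0))) ∧
      -(connectedFour (isingMeasure G Finset.univ β 0 .free) spinAt a) *
          (loopO1PartitionFunction G (Real.tanh β) ∅) ^ 2 ≤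
        (∑ F₁ ∈ tJoins G Set.univ {a 0, a 1}, ∑ F₂ ∈ tJoins G Set.univ {a 2, a 3},
            if (SimpleGraph.fromEdgeSet ((↑F₁ : Set (Sym2 V)) ∪ ↑F₂)).Reachable (a 0) (a 2)
            then Real.tanh β ^ (F₁.card + F₂.card) else 0) +
        (∑ F₁ ∈ tJoins G Set.univ {a 0, a 2}, ∑ F₂ ∈ tJoins G Set.univ {a 1, a 3},
            if (SimpleGraph.fromEdgeSet ((↑F₁ : Set (Sym2 V)) ∪ ↑F₂)).Reachable (a 0) (a 1)
            then Real.tanh β ^ (F₁.card + F₂.card) else 0) +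
        (∑ F₁ ∈ tJoins G Set.univ {a 0, a 3}, ∑ F₂ ∈ tJoins G Set.univ {a 1, a 2},
            if (SimpleGraph.fromEdgeSet ((↑F₁ : Set (Sym2 V)) ∪ ↑F₂)).Reachable (a 0) (a 1)
            then Real.tanh β ^ (F₁.card + F₂.card) else 0) :=
  fun _ _ _ G _ _ hβ a ha =>
    ⟨Summit.CriticalPhenomena.Ising3DConformalLimit.Cruxes.IndependentStrandsJoin.PinchToTetra.ShapeSandwich.connectedFour_mul_sq_le_of_jointSum3
        G hβ a ha,
      Summit.CriticalPhenomena.Ising3DConformalLimit.Cruxes.IndependentStrandsJoin.PinchToTetra.ShapeSandwich.neg_connectedFour_mul_sq_le_jointSum3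
        G hβ a ha⟩

end Summit.CriticalPhenomena.Ising3DConformalLimit.Theorems

end
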